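import Mathlib.AlgebraicGeometry.Birational.Birational
import Literature.AlgebraicGeometry.Motives.FamiliesVHS
import Literature.AlgebraicGeometry.HodgeTheory.GlobalInvariantCycles
import Literature.AlgebraicGeometry.Motives.Sweep1
import Literature.AlgebraicGeometry.Motives.UniversalHypersurfaceFamily
import HarnessLib

/-!
# The quaternionic quartic multiple planes `x₃⁴x₂^{2e} = c (σc)³ ((x₀ − x₁)ψ)²` in a family:
# the statement «Q-FAMILY» (a smooth projective family of models with quasi-projective total space)

Layer `Literature/AlgebraicGeometry/HodgeTheory`; STATEMENT file (definitions only, no named fact, nothing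
proved). Written by the prover seat `hodge-nonav-prover-Bx` (g18, cell `hodge-nonav`) as the first file
of the programme «Q-FAMILY» (memo `PROGRAMME-Q-FAMILY-Bx-g18.md`; planner decision p3 g35
2026-08-29T07:18:27Z) for route `HodgeConjecture/Q8SymplecticPowers` (crux K1Q, stmt-HodgeConjecture-24190).

The route studies, for even `e ≥ 4`, the surfaces `X` smooth projective and birational to the REDUCED
hypersurface `V_(c,ψ) ⊂ ℙ³` cut out by the quartic-in-`x₃` form
`x₃⁴ x₂^{2e} − c (σc)³ ((x₀ − x₁) ψ)²` (`c` a ternary linear form, `ψ` a ternary form of degree `e − 1`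
invariant under the swap `σ` of `x₀, x₁`). A CDK-free «very general on every pencil» reading of the
crux K1Q (memo §0 (A3); route B's reading (a″)) needs these models to come in ONE smooth projective
family over a Zariski-open of the parameter space, with quasi-projective total space — the hypotheses
of `Griffiths1968_holomorphicHodgeSubbundlesQP` (discharged: `griffiths1968_holomorphicHodgeSubbundlesQP_holds`),
of Deligne's finite-index lemma `deligne_finiteIndex_monodromy_le_mumfordTateGroup_of_isQuasiProjectiveOver`
and of the heredity theorems `exists_countable_finiteIndex_le_mumfordTateGroup_of_curve`. This file
fixes that statement:

* `CIdx e`, `cOf`, `ψOf` — the parameter space `𝔸^{CIdx e}` of pairs `(c, ψ₀)` and the forms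
  `c = cOf a`, `ψ = ψOf a := ψ₀ + σ^*ψ₀` (σ-invariant by construction; in characteristic `0` every
  σ-invariant form is of this shape, `ψ₀ = ψ/2`, so lines of admissible pairs lift to lines of `𝔸^{CIdx e}`);
* `quarticForm e c ψ` — the route's form, VERBATIM the form in the leaf `Q8SurfacePowersHodge`;
* `base W`, `coeffs W t` — an open subscheme `W ⊆ 𝔸^{CIdx e}` as a `ℂ`-scheme and the coefficient
  vector of a complex point (`Spec.preimage`, the idiom of `UniversalHypersurface.pointHom`);
* **`QFamily e`** — the programme's target: ∃ a non-empty open `W ⊆ 𝔸^{CIdx e}`, a smooth projective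
  family `π : 𝒳 ⟶ base W` of relative dimension `2` with `𝒳` and `base W` quasi-projective and
  `base W` smooth, whose fibre over every complex point `t` is birational over `ℂ` to every hypersurface
  cut out in `ℙ³` by `quarticForm e (cOf (coeffs W t)) (ψOf (coeffs W t))`. (The fibrewise `Q₈`
  deck maps are a separate statement «M1» of the programme, not part of `QFamily`.)

Intended proof (memo §2, not in this file): resolution of the integral generic fibre over `ℂ(a)`
(`Resolution.exists_isResolution_isProjectiveOver_of_isProjectiveOver`, from `Hironaka1964_holds`) and
spreading out over a basic open of the parameter space (EGA IV₃ §8; the tree's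
`SpreadModelTower`/`SpreadModelDataSpread`/`SncModelSpread`, `exists_forall_mem_smoothLocus_of_smooth_generic`,
`smooth_of_isRegular_of_perfectField`). Honest scope: a statement; nothing is proved here and nothing
here bears on HC.

## References

* [EGAIV3] A. Grothendieck, J. Dieudonné, EGA IV₃, Publ. Math. IHÉS 28 (1966), §8.10.5, §9 (spreading
  out from the generic fibre).
* [Kollar2007] J. Kollár, Lectures on Resolution of Singularities (2007), Thm. 3.27, §3.3.
* [Hironaka1964] H. Hironaka, Resolution of singularities …, Ann. of Math. 79 (1964), Main Theorem I.
-/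

noncomputable section

open CategoryTheory AlgebraicGeometry MvPolynomial
open Literature.AlgebraicGeometry.Motives Literature.AlgebraicGeometry.Motives.UniversalHypersurface

namespace Literature.AlgebraicGeometry.HodgeTheory.Q8Family

/-- **Coefficient index** of the parameter pairs `(c, ψ₀)` of the quaternionic quartic family: `c` a
ternary linear form, `ψ₀` a ternary form of degree `e − 1` — the index type
`{d : Fin 3 →₀ ℕ // d.degree = 1} ⊕ {d // d.degree = e − 1}` of the genericity device of the leaf
`Q8SurfacePowersHodge`, spelled with `UniversalHypersurface.DegIndex 1 _` (`Fin (1 + 2) = Fin 3`) for its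
`Fintype` instance. [cite: Kollar2007, §3.3] -/
abbrev CIdx (e : ℕ) : Type := DegIndex 1 1 ⊕ DegIndex 1 (e - 1)

/-- The linear form `c = Σ_{|d| = 1} a_d x^d` of a coefficient vector `a`. [cite: Kollar2007, §3.3] -/
def cOf {e : ℕ} (a : CIdx e → ℂ) : MvPolynomial (Fin 3) ℂ :=
  ∑ d : DegIndex 1 1, monomial d.1 (a (Sum.inl d))

/-- The σ-INVARIANT form `ψ = ψ₀ + σ^*ψ₀` of a coefficient vector (`σ` swaps `x₀, x₁`;
`ψ₀ = Σ_{|d| = e−1} a_d x^d`). In characteristic `0` every σ-invariant form of degree `e − 1` arises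
(`ψ₀ := ψ/2`). [cite: Kollar2007, §3.3] -/
def ψOf {e : ℕ} (a : CIdx e → ℂ) : MvPolynomial (Fin 3) ℂ :=
  (∑ d : DegIndex 1 (e - 1), monomial d.1 (a (Sum.inr d))) +
    rename (Equiv.swap (0 : Fin 3) 1) (∑ d : DegIndex 1 (e - 1), monomial d.1 (a (Sum.inr d)))

/-- **The quaternionic quartic form** `x₃⁴ x₂^{2e} − c (σc)³ ((x₀ − x₁) ψ)² ∈ ℂ[x₀, …, x₃]` of the pair
`(c, ψ)` — verbatim the form of the leaf `Summit.HodgeConjecture.HodgeConjecture.Theses.Q8SymplecticPowers.Q8SurfacePowersHodge`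
(its hypersurface in `ℙ³` is the quartic multiple plane `V_(c,ψ)`, a `Q₈`-Galois cover of `ℙ²` after
normalisation). [cite: Kollar2007, §3.3] -/
def quarticForm (e : ℕ) (c ψ : MvPolynomial (Fin 3) ℂ) : MvPolynomial (Fin 4) ℂ :=
  X (Fin.last 3) ^ 4 * X (Fin.castSucc 2) ^ (2 * e) -
    rename Fin.castSucc (c * rename (Equiv.swap (0 : Fin 3) 1) c ^ 3 * ((X 0 - X 1) * ψ) ^ 2)

/-- **The base**: an open subscheme `W ⊆ 𝔸^{CIdx e} = Spec ℂ[a_i | i ∈ CIdx e]` as a `ℂ`-scheme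
(structure map `W ⊆ 𝔸 → Spec ℂ`; the idiom of `UniversalHypersurface.base`). [cite: EGAIV3, §8] -/
def base {e : ℕ} (W : (Spec (.of (MvPolynomial (CIdx e) ℂ))).Opens) : SchemeOver ℂ :=
  Over.mk (W.ι ≫ Spec.map (CommRingCat.ofHom (algebraMap ℂ (MvPolynomial (CIdx e) ℂ))))

/-- **The coefficient vector `a(t) ∈ ℂ^{CIdx e}` of a complex point `t` of the base**: the values at
`t` of the coordinate functions `a_i` (`Spec.preimage` of the point `Spec ℂ → W ⊆ Spec ℂ[a]`, as in
`UniversalHypersurface.pointHom`). [cite: EGAIV3, §8] -/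
def coeffs {e : ℕ} (W : (Spec (.of (MvPolynomial (CIdx e) ℂ))).Opens) (t : ComplexPoints (base W)) :
    CIdx e → ℂ :=
  fun i ↦ (Spec.preimage (t.left ≫ W.ι)).hom (X i)

/-- **«Q-FAMILY_e»** (programme statement; to be discharged as `qFamily_holds`, NOT proved here): over a
NON-EMPTY Zariski-open `W` of the parameter space `𝔸^{CIdx e}` of pairs `(c, ψ₀)` there is a smooth
projective family `π : 𝒳 → W` of relative dimension `2` whose total space `𝒳` and base `W` are
quasi-projective, the base being smooth (of dimension `card (CIdx e)`), and whose fibre over every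
complex point `t` is birational over `ℂ` to every hypersurface `V ⊂ ℙ³` cut out by the quaternionic
quartic form of `(c, ψ) = (cOf (a t), ψOf (a t))`. Intended route: resolve the integral generic fibre
over `ℂ(a)` (Hironaka, Kollár Thm. 3.27) and spread out over a basic open (EGA IV₃ 8.10.5, 9.7.7,
IV₄ 17.7.8). [cite: EGAIV3, §8.10.5] [cite: Kollar2007, Thm. 3.27] [cite: Hironaka1964, Main Theorem I] -/
def QFamily (e : ℕ) : Prop :=
  ∃ (W : (Spec (.of (MvPolynomial (CIdx e) ℂ))).Opens) (𝒳 : SchemeOver ℂ) (π : 𝒳 ⟶ base W),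
    Nonempty (ComplexPoints (base W)) ∧
    IsSmoothProjectiveFamily π 2 ∧ IsQuasiProjectiveOver 𝒳 ∧ IsQuasiProjectiveOver (base W) ∧
    AlgebraicGeometry.SmoothOfRelativeDimension (Fintype.card (CIdx e)) (base W).hom ∧
    ∀ (t : ComplexPoints (base W)) ⦃V : SchemeOver ℂ⦄,
      IsHypersurfaceCutOutBy 3 (quarticForm e (cOf (coeffs W t)) (ψOf (coeffs W t))) V →
        AlgebraicGeometry.Scheme.BirationalOver (fiberOver π t).hom V.hom

end Literature.AlgebraicGeometry.HodgeTheory.Q8Family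

end
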